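import Literature.MathematicalPhysics.QuantumFieldTheory.Balaban1983to89.B9Thm37GlueTorusCov

/-!
# Beta / MultiscaleDistance — THE SCALE-ADAPTED SITE DISTANCE (node (m5) ∕ the weight of node (w2′) of the O.2 skeleton
# §8.5): on ANY bond structure `src, tgt : Bd → St` with a site scale `n : St → ℕ`, the bond between `x` and `y` is given the
# length `min(1∕n(x), 1∕n(y))` and `d_n(x, y)` is the infimum of the weighted lengths of the walks from `x` to `y` in the bond
# graph — the MODEL of the weighted distance `d(y, y′)` of [B6] (2.46) p. 231 («a new definition of distance, taking into
# account that natural scales are different on different subdomains B^j(Λ_j)»; [B9] p. 397 uses it as «the weighted distance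
# d(y, y′) defined by (2.36) [sic] in [4]»): `n` fine bonds across a cell of scale `n` cost ONE unit
# (unit `b2b-balaban-beta-d4-p2`, GEN 8, MODEL crew; claim «MULTISCALE-DECAY-MODEL» journal l.18614, part (K))

HONEST FRAMING: discharging `BetaPertH` makes Bałaban's UV stability UNCONDITIONAL — NOT the continuum limit, NOT the
Clay problem.  HONEST DEPENDENCY (verbatim): «continuum YM on T⁴ ⇐ BetaPertH ∧ nine spine estimates (0/9 proved);
BetaPertH ⇐ (D1) ∧ (D4) ∧ CAP+tail; G-an2-4 gates asym, D1 and NE2/3/4.»  THIS MODULE DISCHARGES NOTHING of `BetaPertH`,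
asserts NOTHING printed and cites nothing as a fact (ABSOLUTE RULE): [folklore] shortest-path bookkeeping (Mathlib
`SimpleGraph.Walk`, `Real.iInf_*`) about DATA (`src`, `tgt`, `n`); [B6] = `Balaban1984PropagatorsII` (2.46) p. 231 and [B9] =
`Balaban1985BackgroundPropagators` (3.39)–(3.42) p. 397 are LOCI of the SHAPE only; print's region geometry ([B6] (2.1)–(2.2),
which cells are adjacent) is NOT modelled — the scale `n` is free data.  No class change on row D4 (critical-path width 0;
D4 DISCHARGE NO DATE); NOT BetaPertH, NOT continuum, NOT Clay, NOT summit progress.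

CONTENT (kernel, 0 sorry).  §1 the bond graph `bondGraph src tgt` (Mathlib `SimpleGraph.fromRel`), the symmetric step length
`slen n x y = min((n x)⁻¹, (n y)⁻¹)`, the weighted walk length `wlen`, and **`sdist src tgt n x y = ⨅_{walks} wlen`**; `sdist ≥ 0`,
`sdist x x = 0`, `sdist ≤ wlen p`.  §2 THE ONE-STEP LIPSCHITZ PROPERTY: `sdist x j ≤ slen x z + sdist z j` for adjacent `x, z`
(both reachability cases), hence for every bond `b`: **`|sdist (tgt b) j − sdist (src b) j| ≤ slen (src b) (tgt b) ≤ 1∕n(b±)`** —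
the hypothesis shape `hφ` of `MultiscaleConjError.dPart_ge_local(_cosh)` with `θ_b = κ·slen`.  §3 COMB CHAINS: along a pv21
`Comb` whose block `β` has constant scale `S`, **`|sdist x j − sdist (base β) j| ≤ depth(x)∕S`** — the blockwise oscillation
budget `Θ` of `MultiscaleConjError.qPart_gMean_ge_local` (`≤ 2·depth_max∕S`, i.e. `< 2d` on a cube of side `S`).  §4 THE CHEAP
DIRECTION: `n ≤ n_max` ⟹ **`dist_bondGraph(x, y)∕n_max ≤ sdist x y`** (Mathlib `SimpleGraph.dist_le`), so `e^{−κ·sdist}` IS decay.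
-/

namespace Summit.QuantumFields.BalabanUV.Beta.MultiscaleDistance

open Finset Function
open Literature.MathematicalPhysics.QuantumFieldTheory.Balaban1983to89.B9Thm37GlueTorusCov (Comb)

noncomputable section

variable {St Bd B : Type} (src tgt : Bd → St) (n : St → ℕ)

/-! ## §1 The bond graph, the scale-adapted step length, weighted walks, the distance -/

/-- The (symmetric, loop-free) bond graph of the bond structure `src, tgt`: `x ~ y` iff `x ≠ y` and some bond joins them in
either direction (MODEL bookkeeping). [folklore] -/
def bondGraph : SimpleGraph St := SimpleGraph.fromRel fun x y => ∃ b, src b = x ∧ tgt b = y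

omit n in
/-- A bond with distinct endpoints is an edge of the bond graph, in both directions. [folklore] -/
theorem adj_of_bond (b : Bd) (h : src b ≠ tgt b) :
    (bondGraph src tgt).Adj (src b) (tgt b) ∧ (bondGraph src tgt).Adj (tgt b) (src b) := by
  have h1 : (bondGraph src tgt).Adj (src b) (tgt b) := by
    rw [bondGraph, SimpleGraph.fromRel_adj]
    exact ⟨h, Or.inl ⟨b, rfl, rfl⟩⟩
  exact ⟨h1, h1.symm⟩

/-- **The scale-adapted length of a step between `x` and `y`**: `min((n x)⁻¹, (n y)⁻¹)` — a fine bond inside a cell of scale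
`n` costs `1/n`, a bond between cells of different scales costs the SMALLER of the two (MODEL of the bonds of the lattice
`Λ_j` in [B6] (2.46)). [cite: Balaban1984PropagatorsII, (2.46) p.231] -/
def slen (x y : St) : ℝ := min ((n x : ℝ)⁻¹) ((n y : ℝ)⁻¹)

omit src tgt in
/-- [folklore] -/
theorem slen_comm (x y : St) : slen n x y = slen n y x := min_comm _ _

omit src tgt in
/-- [folklore] -/
theorem slen_nonneg (x y : St) : 0 ≤ slen n x y :=
  le_min (inv_nonneg.mpr (Nat.cast_nonneg _)) (inv_nonneg.mpr (Nat.cast_nonneg _))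

omit src tgt in
/-- [folklore] -/
theorem slen_le_left (x y : St) : slen n x y ≤ (n x : ℝ)⁻¹ := min_le_left _ _

omit src tgt in
/-- [folklore] -/
theorem slen_le_right (x y : St) : slen n x y ≤ (n y : ℝ)⁻¹ := min_le_right _ _

omit src tgt in
/-- With scales `≥ 1` a step costs at most `1`. [folklore] -/
theorem slen_le_one (hn : ∀ x, 1 ≤ n x) (x y : St) : slen n x y ≤ 1 :=
  (slen_le_left n x y).trans (inv_le_one_of_one_le₀ (by exact_mod_cast hn x))

omit src tgt in
/-- With scales `≤ n_max` a step costs at least `1/n_max`. [folklore] -/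
theorem inv_le_slen {nmax : ℕ} (hn : ∀ x, 1 ≤ n x) (hmax : ∀ x, n x ≤ nmax) (x y : St) : (nmax : ℝ)⁻¹ ≤ slen n x y := by
  have h : ∀ z, (nmax : ℝ)⁻¹ ≤ (n z : ℝ)⁻¹ := fun z =>
    inv_anti₀ (by exact_mod_cast hn z) (by exact_mod_cast hmax z)
  exact le_min (h x) (h y)

/-- **The weighted length of a walk**: the sum of the scale-adapted step lengths along it. [folklore] -/
def wlen : ∀ {x y : St}, (bondGraph src tgt).Walk x y → ℝ
  | _, _, SimpleGraph.Walk.nil => 0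
  | x, _, @SimpleGraph.Walk.cons _ _ _ z _ _ p => slen n x z + wlen p

/-- [folklore] -/
theorem wlen_nil (x : St) : wlen src tgt n (SimpleGraph.Walk.nil : (bondGraph src tgt).Walk x x) = 0 := rfl

/-- [folklore] -/
theorem wlen_cons {x z y : St} (h : (bondGraph src tgt).Adj x z) (p : (bondGraph src tgt).Walk z y) :
    wlen src tgt n (SimpleGraph.Walk.cons h p) = slen n x z + wlen src tgt n p := rfl

/-- Weighted lengths are `≥ 0`. [folklore] -/
theorem wlen_nonneg : ∀ {x y : St} (p : (bondGraph src tgt).Walk x y), 0 ≤ wlen src tgt n p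
  | _, _, SimpleGraph.Walk.nil => le_rfl
  | _, _, SimpleGraph.Walk.cons _ p => add_nonneg (slen_nonneg n _ _) (wlen_nonneg p)

/-- With scales `≤ n_max`: `length(p)/n_max ≤ wlen p`. [folklore] -/
theorem length_mul_inv_le_wlen {nmax : ℕ} (hn : ∀ x, 1 ≤ n x) (hmax : ∀ x, n x ≤ nmax) :
    ∀ {x y : St} (p : (bondGraph src tgt).Walk x y), (p.length : ℝ) * (nmax : ℝ)⁻¹ ≤ wlen src tgt n p
  | _, _, SimpleGraph.Walk.nil => by simp [wlen_nil]
  | _, _, SimpleGraph.Walk.cons h p => by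
      rw [SimpleGraph.Walk.length_cons, wlen_cons, Nat.cast_succ, add_mul, one_mul, add_comm]
      exact add_le_add (inv_le_slen n hn hmax _ _) (length_mul_inv_le_wlen hn hmax p)

/-- **THE SCALE-ADAPTED DISTANCE** `d_n(x, y)`: the infimum of the weighted lengths of the walks from `x` to `y` in the bond
graph (`= 0` if there is none — never the case on a torus).  MODEL of [B6] (2.46) («where the infimum is taken over all
admissible contours … with end-points y, y′»), the distance in which [B9] Thm 3.1 (3.42) decays.
[cite: Balaban1984PropagatorsII, (2.46) p.231; Balaban1985BackgroundPropagators, Thm 3.1 (3.42) p.397] -/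
def sdist (x y : St) : ℝ := ⨅ p : (bondGraph src tgt).Walk x y, wlen src tgt n p

/-- `d_n ≥ 0`. [folklore] -/
theorem sdist_nonneg (x y : St) : 0 ≤ sdist src tgt n x y := Real.iInf_nonneg fun p => wlen_nonneg src tgt n p

/-- `d_n(x, y) ≤` the weighted length of any walk. [folklore] -/
theorem sdist_le_wlen {x y : St} (p : (bondGraph src tgt).Walk x y) : sdist src tgt n x y ≤ wlen src tgt n p :=
  ciInf_le ⟨0, by rintro _ ⟨q, rfl⟩; exact wlen_nonneg src tgt n q⟩ p

/-- `d_n(x, x) = 0`. [folklore] -/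
theorem sdist_self (x : St) : sdist src tgt n x x = 0 :=
  le_antisymm (by simpa [wlen_nil] using sdist_le_wlen src tgt n (SimpleGraph.Walk.nil : (bondGraph src tgt).Walk x x))
    (sdist_nonneg src tgt n x x)

/-! ## §2 The one-step Lipschitz property -/

/-- **One step**: for adjacent `x, z` and any target `j`, `d_n(x, j) ≤ slen(x, z) + d_n(z, j)` (if `z` reaches `j`, prefix the
step to every walk; if not, neither does `x`, and both distances vanish). [folklore] -/
theorem sdist_le_slen_add {x z : St} (h : (bondGraph src tgt).Adj x z) (j : St) :
    sdist src tgt n x j ≤ slen n x z + sdist src tgt n z j := by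
  by_cases hne : Nonempty ((bondGraph src tgt).Walk z j)
  · have hall : ∀ p : (bondGraph src tgt).Walk z j, sdist src tgt n x j - slen n x z ≤ wlen src tgt n p := by
      intro p
      have h1 := sdist_le_wlen src tgt n (SimpleGraph.Walk.cons h p)
      rw [wlen_cons] at h1
      linarith
    have h2 : sdist src tgt n x j - slen n x z ≤ sdist src tgt n z j := le_ciInf hall
    linarith
  · have hE : IsEmpty ((bondGraph src tgt).Walk z j) := not_nonempty_iff.mp hne
    have hE' : IsEmpty ((bondGraph src tgt).Walk x j) :=
      ⟨fun q => hne ⟨SimpleGraph.Walk.cons h.symm q⟩⟩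
    rw [sdist, sdist, Real.iInf_of_isEmpty, Real.iInf_of_isEmpty, add_zero]
    exact slen_nonneg n x z

/-- **Every bond is a Lipschitz step of the distance to any target**: `d_n(b₊, j) ≤ slen(b₋, b₊) + d_n(b₋, j)`. [folklore] -/
theorem sdist_tgt_le (b : Bd) (j : St) :
    sdist src tgt n (tgt b) j ≤ slen n (src b) (tgt b) + sdist src tgt n (src b) j := by
  by_cases h : src b = tgt b
  · rw [h]; linarith [slen_nonneg n (tgt b) (tgt b)]
  · rw [slen_comm]
    exact sdist_le_slen_add src tgt n (adj_of_bond src tgt b h).2 j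

/-- … and `d_n(b₋, j) ≤ slen(b₋, b₊) + d_n(b₊, j)`. [folklore] -/
theorem sdist_src_le (b : Bd) (j : St) :
    sdist src tgt n (src b) j ≤ slen n (src b) (tgt b) + sdist src tgt n (tgt b) j := by
  by_cases h : src b = tgt b
  · rw [h]; linarith [slen_nonneg n (tgt b) (tgt b)]
  · exact sdist_le_slen_add src tgt n (adj_of_bond src tgt b h).1 j

/-- **THE ONE-BOND LIPSCHITZ BOUND**: `|d_n(b₊, j) − d_n(b₋, j)| ≤ slen(b₋, b₊)` — the hypothesis `hφ` of
`MultiscaleConjError.dPart_ge_local(_cosh)` for the weight `κ·d_n(·, j)` with the bondwise budget `θ_b = κ·slen(b₋, b₊)`.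
[cite: Balaban1984PropagatorsII, (2.46) p.231] -/
theorem abs_sdist_tgt_sub_src_le (b : Bd) (j : St) :
    |sdist src tgt n (tgt b) j - sdist src tgt n (src b) j| ≤ slen n (src b) (tgt b) :=
  abs_sub_le_iff.mpr ⟨by linarith [sdist_tgt_le src tgt n b j], by linarith [sdist_src_le src tgt n b j]⟩

/-- The bondwise budget is at most `1/n` at EITHER endpoint: `slen(b₋, b₊) ≤ (n b₋)⁻¹` and `≤ (n b₊)⁻¹`. [folklore] -/
theorem slen_bond_le (b : Bd) :
    slen n (src b) (tgt b) ≤ (n (src b) : ℝ)⁻¹ ∧ slen n (src b) (tgt b) ≤ (n (tgt b) : ℝ)⁻¹ :=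
  ⟨slen_le_left n _ _, slen_le_right n _ _⟩

/-! ## §3 Comb chains: the blockwise oscillation on a block of constant scale -/

/-- **Along a comb whose block `β` has constant scale `S`, the distance to any target oscillates by at most `depth/S`**:
`|d_n(x, j) − d_n(base β, j)| ≤ depth(x)·S⁻¹` for every `x` of the block (induction on the depth through the parent bonds;
pv21 `Comb` BY NAME). [cite: Balaban1985BackgroundPropagators, (3.19) p.393] -/
theorem abs_sdist_sub_base_le (K : Comb src tgt B) {β : B} {S : ℕ} (hS : ∀ x, K.blk x = β → n x = S) (j : St) :
    ∀ (m : ℕ) (x : St), K.depth x = m → K.blk x = β →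
      |sdist src tgt n x j - sdist src tgt n (K.base β) j| ≤ (m : ℝ) * (S : ℝ)⁻¹ := by
  intro m
  induction m with
  | zero =>
      intro x hx hβ
      have e : x = K.base β := by rw [← hβ]; exact K.eq_base x hx
      rw [e, sub_self, abs_zero, Nat.cast_zero, zero_mul]
  | succ m ih =>
      intro x hx hβ
      have hx0 : K.depth x ≠ 0 := by rw [hx]; exact Nat.succ_ne_zero m
      have hpar : K.depth (K.parent x) = m := by
        have := K.depth_parent x hx0
        rw [hx] at this
        omega
      have hβ' : K.blk (K.parent x) = β := by rw [K.blk_parent x hx0, hβ]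
      have h1 := ih (K.parent x) hpar hβ'
      -- the parent bond: src = parent, tgt = x
      have h2 := abs_sdist_tgt_sub_src_le src tgt n (K.pbond x) j
      rw [K.src_pbond x hx0, K.tgt_pbond x hx0] at h2
      have h3 : slen n (K.parent x) x ≤ (S : ℝ)⁻¹ := by
        have := slen_le_right n (K.parent x) x
        rw [hS x hβ] at this
        exact this
      calc |sdist src tgt n x j - sdist src tgt n (K.base β) j|
          = |(sdist src tgt n x j - sdist src tgt n (K.parent x) j) +
              (sdist src tgt n (K.parent x) j - sdist src tgt n (K.base β) j)| := by ring_nf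
        _ ≤ |sdist src tgt n x j - sdist src tgt n (K.parent x) j| +
              |sdist src tgt n (K.parent x) j - sdist src tgt n (K.base β) j| := abs_add_le _ _
        _ ≤ (S : ℝ)⁻¹ + (m : ℝ) * (S : ℝ)⁻¹ := add_le_add (h2.trans h3) h1
        _ = ((m + 1 : ℕ) : ℝ) * (S : ℝ)⁻¹ := by push_cast; ring

/-- **The blockwise oscillation budget**: two sites of a block of constant scale `S` and depths `≤ D` see distances to any
target differing by at most `2D/S` (`< 2d` on a cube of side `S`, where `D = d(S − 1)`) — the hypothesis `hosc` of
`MultiscaleConjError.qPart_gMean_ge_local` for the weight `κ·d_n(·, j)` with `Θ = 2κD/S`. [cite: Balaban1985BackgroundPropagators, (3.24) p.394] -/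
theorem abs_sdist_sub_sdist_le_of_blk (K : Comb src tgt B) {β : B} {S D : ℕ} (hS : ∀ x, K.blk x = β → n x = S)
    (hD : ∀ x, K.blk x = β → K.depth x ≤ D) (j : St) {x x' : St} (hx : K.blk x = β) (hx' : K.blk x' = β) :
    |sdist src tgt n x j - sdist src tgt n x' j| ≤ 2 * (D : ℝ) * (S : ℝ)⁻¹ := by
  have h1 := abs_sdist_sub_base_le src tgt n K hS j (K.depth x) x rfl hx
  have h2 := abs_sdist_sub_base_le src tgt n K hS j (K.depth x') x' rfl hx'
  have hS0 : 0 ≤ (S : ℝ)⁻¹ := inv_nonneg.mpr (Nat.cast_nonneg _)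
  have h1' : |sdist src tgt n x j - sdist src tgt n (K.base β) j| ≤ (D : ℝ) * (S : ℝ)⁻¹ :=
    h1.trans (mul_le_mul_of_nonneg_right (by exact_mod_cast hD x hx) hS0)
  have h2' : |sdist src tgt n x' j - sdist src tgt n (K.base β) j| ≤ (D : ℝ) * (S : ℝ)⁻¹ :=
    h2.trans (mul_le_mul_of_nonneg_right (by exact_mod_cast hD x' hx') hS0)
  rw [abs_sub_comm] at h2'
  calc |sdist src tgt n x j - sdist src tgt n x' j|
      = |(sdist src tgt n x j - sdist src tgt n (K.base β) j) + (sdist src tgt n (K.base β) j - sdist src tgt n x' j)| := by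
        ring_nf
    _ ≤ _ := abs_add_le _ _
    _ ≤ (D : ℝ) * (S : ℝ)⁻¹ + (D : ℝ) * (S : ℝ)⁻¹ := add_le_add h1' h2'
    _ = 2 * (D : ℝ) * (S : ℝ)⁻¹ := by ring

/-! ## §4 The cheap direction: the distance dominates the graph distance over the largest scale -/

/-- **`e^{−κ d_n}` IS decay**: with scales in `[1, n_max]`, `dist_bondGraph(x, y)/n_max ≤ d_n(x, y)` (for unreachable pairs
both sides vanish). [folklore] -/
theorem dist_mul_inv_le_sdist {nmax : ℕ} (hn : ∀ x, 1 ≤ n x) (hmax : ∀ x, n x ≤ nmax) (x y : St) :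
    ((bondGraph src tgt).dist x y : ℝ) * (nmax : ℝ)⁻¹ ≤ sdist src tgt n x y := by
  by_cases hne : Nonempty ((bondGraph src tgt).Walk x y)
  · refine le_ciInf fun p => ?_
    have h1 : ((bondGraph src tgt).dist x y : ℝ) ≤ p.length := by exact_mod_cast SimpleGraph.dist_le p
    exact (mul_le_mul_of_nonneg_right h1 (inv_nonneg.mpr (Nat.cast_nonneg _))).trans
      (length_mul_inv_le_wlen src tgt n hn hmax p)
  · have h0 : (bondGraph src tgt).dist x y = 0 := SimpleGraph.dist_eq_zero_of_not_reachable hne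
    rw [h0, Nat.cast_zero, zero_mul]
    exact sdist_nonneg src tgt n x y

end

end Summit.QuantumFields.BalabanUV.Beta.MultiscaleDistance
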